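import Mathlib
import Summits.NavierStokesRegularity.NavierStokesRegularity.Theses.AxisymmetricExtremality
import Summits.NavierStokesRegularity.NavierStokesRegularity.Theorems.AxisymmetricExtremalityAxisymmetricKatoGlobalNoSwirlStratum
import Literature.Analysis.FluidPDE.AxisymmetricReflection
import HarnessLib

/-!
# Strategist s16-g7 — typed companion of `STRATEGY-CENSUS-s16-g7.md`

Crux `AxisymmetricKatoGlobal` (item `stmt-NavierStokesRegularity-15453`) of
`route-NavierStokesRegularity-AxisymmetricExtremality`.  This file records, sorry-free, the typed
content of the second independent strategy census (family `s`, gen 7):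

* `NoAxisymMinimalBlowupDatum` (W0) — the STRICTLY-WEAKER INTERMEDIATE that `closes` actually
  consumes (the threshold instance of the crux), with `navierStokesRegularity_of_W0` (the route's
  deciding theorem with W0 in place of the crux) and `w0_of_axisymmetricKatoGlobal`;
* the SYMMETRY LEDGER, row `O(2)` (rotations + meridian reflections): a minimal blow-up datum with
  that symmetry is swirl-free (`IsAxisymmetric.hasNoSwirl_of_reflY_eq`, tree) hence globally
  Kato-regular (`NoSwirlStratum.axisymmetricKatoGlobal_noSwirl_stratum`, tree) — so the
  "dihedral/O(2) bypass" statement `MinimalDatumO2` is EQUIVALENT to the summit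
  (`minimalDatumO2_iff`): a relocation of the whole difficulty, not a weaker intermediate;
* rows `D∞` (swirl odd in `z`, the class of Hou's numerical candidate arXiv:2107.06509) and
  `C∞h` (swirl even in `z`): typed restrictions of the crux, recorded as trivial weakenings.

Nothing here is a route item; no `sorry`.
-/

open MeasureTheory
open Literature.Analysis.FluidPDE
open Summit.NavierStokesRegularity.NavierStokesRegularity.Theses.AxisymmetricExtremality

namespace Summit.NavierStokesRegularity.NavierStokesRegularity.Cruxes.AxisymmetricKatoGlobal.StrategistS16g7

/-! ## 1. The weaker intermediate W0 consumed by `closes` -/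

/-- **W0 — no axisymmetric `Ḣ^{1/2}`-minimal blow-up datum.**  For every `ν > 0` there is no
Rusin–Šverák minimal blow-up datum `(u₀, g)` (`IsMinimalBlowupDatum ν u₀ g`: `u₀ ∈ L³`, represented
by `g`, weakly divergence-free, `‖g‖ = ρ_max^pure(ν)`, no global Kato solution) which is axisymmetric
about the `x₂`-axis.  This is exactly the instance of `AxisymmetricKatoGlobal` used by `closes`. -/
def NoAxisymMinimalBlowupDatum : Prop :=
  ∀ ν : ℝ, 0 < ν → ∀ (u₀ : EuclideanSpace ℝ (Fin 3) → EuclideanSpace ℝ (Fin 3))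
    (g : Literature.Analysis.FunctionSpaces.HomSobolev (EuclideanSpace ℝ (Fin 3))
      (EuclideanSpace ℂ (Fin 3)) (1 / 2 : ℝ)),
    IsMinimalBlowupDatum ν u₀ g → IsAxisymmetric u₀ → False

/-- The crux implies W0 (one line: minimality's last clause is `¬ HasGlobalKatoSolution`). -/
theorem w0_of_axisymmetricKatoGlobal (h : AxisymmetricKatoGlobal) : NoAxisymMinimalBlowupDatum := by
  intro ν hν u₀ g hmin hax
  obtain ⟨hL3, hrep, hdiv, -, hnot⟩ := hmin
  exact hnot (h ν hν u₀ g hL3 hrep hdiv (fun θ x => hax θ x))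

/-- **The route's deciding theorem with W0 in place of the crux** (same two other binders, same
pure-logic proof as `closes`): W0 is a drop-in replacement for `AxisymmetricKatoGlobal`. -/
theorem navierStokesRegularity_of_W0 (h₂ : MinimalDatumPFold) (h₄ : PFoldToAxisymmetric)
    (hW : NoAxisymMinimalBlowupDatum) : NavierStokesRegularity := by
  show Literature.NS.NavierStokesExistenceSmoothR3
  intro ν hν u₀ hsm hdiv hdec
  by_contra hno
  obtain ⟨u₁, g, hmin, hax⟩ := h₄ ν hν (h₂ ν hν ⟨u₀, hsm, hdiv, hdec, hno⟩)
  exact hW ν hν u₁ g hmin (fun θ x => hax θ x)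

/-! ## 2. Symmetry ledger, row `O(2)`: reflections kill the swirl, so the bypass is the summit -/

/-- **No minimal blow-up datum is `O(2)`-symmetric.**  If `(u₀, g)` is a minimal blow-up datum,
axisymmetric AND equivariant under the meridian reflection `σ (x₀,x₁,x₂) = (x₀,−x₁,x₂)`, then
`u₀` is swirl-free (tree: `IsAxisymmetric.hasNoSwirl_of_reflY_eq`), hence has a global Kato
solution (tree: `NoSwirlStratum.axisymmetricKatoGlobal_noSwirl_stratum`, unconditional) —
contradicting the last clause of minimality. -/
theorem false_of_minimalBlowupDatum_reflY {ν : ℝ} (hν : 0 < ν)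
    {u₀ : EuclideanSpace ℝ (Fin 3) → EuclideanSpace ℝ (Fin 3)}
    {g : Literature.Analysis.FunctionSpaces.HomSobolev (EuclideanSpace ℝ (Fin 3))
      (EuclideanSpace ℂ (Fin 3)) (1 / 2 : ℝ)}
    (hmin : IsMinimalBlowupDatum ν u₀ g) (hax : IsAxisymmetric u₀)
    (hσ : ∀ x, u₀ (reflY x) = reflY (u₀ x)) : False := by
  obtain ⟨hL3, -, hdiv, -, hnot⟩ := hmin
  exact hnot
    (Summit.NavierStokesRegularity.NavierStokesRegularity.Theorems.AxisymmetricKatoGlobal.NoSwirlStratum.axisymmetricKatoGlobal_noSwirl_stratum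
      ν hν u₀ hL3 hdiv (fun θ x => hax θ x) (hax.hasNoSwirl_of_reflY_eq hσ))

/-- **The `O(2)` bypass statement** ("if Clay (A) fails at viscosity `ν`, an `O(2)`-symmetric minimal
blow-up datum exists") — the extremality half `Ext(O(2))` of an `Ext(Σ) ∧ Reg(Σ)` architecture with
`Σ = O(2)`, whose regularity half `Reg(O(2))` is KNOWN. -/
def MinimalDatumO2 : Prop :=
  ∀ ν : ℝ, 0 < ν →
    (∃ v₀ : EuclideanSpace ℝ (Fin 3) → EuclideanSpace ℝ (Fin 3), ContDiff ℝ (⊤ : ℕ∞) v₀ ∧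
      Literature.Analysis.FluidPDE.NSWave0.IsDivFree v₀ ∧
      Literature.Analysis.FluidPDE.HasRapidSpatialDecay v₀ ∧
      ¬ ∃ (u : ℝ → EuclideanSpace ℝ (Fin 3) → EuclideanSpace ℝ (Fin 3))
          (p : ℝ → EuclideanSpace ℝ (Fin 3) → ℝ),
          Literature.Analysis.FluidPDE.IsSmoothOnHalfSpace u ∧
          Literature.Analysis.FluidPDE.IsSmoothOnHalfSpace p ∧
          Literature.Analysis.FluidPDE.IsNavierStokesSolution ν 0 v₀ u p ∧
          Literature.Analysis.FluidPDE.HasBoundedEnergy u) →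
    ∃ (u₀ : EuclideanSpace ℝ (Fin 3) → EuclideanSpace ℝ (Fin 3))
      (g : Literature.Analysis.FunctionSpaces.HomSobolev (EuclideanSpace ℝ (Fin 3))
        (EuclideanSpace ℂ (Fin 3)) (1 / 2 : ℝ)),
      IsMinimalBlowupDatum ν u₀ g ∧ IsAxisymmetric u₀ ∧ ∀ x, u₀ (reflY x) = reflY (u₀ x)

/-- `Ext(O(2))` alone decides the summit (because `Reg(O(2))` is a theorem of the tree) … -/
theorem navierStokesRegularity_of_minimalDatumO2 (h : MinimalDatumO2) : NavierStokesRegularity := by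
  show Literature.NS.NavierStokesExistenceSmoothR3
  intro ν hν u₀ hsm hdiv hdec
  by_contra hno
  obtain ⟨u₁, g, hmin, hax, hσ⟩ := h ν hν ⟨u₀, hsm, hdiv, hdec, hno⟩
  exact false_of_minimalBlowupDatum_reflY hν hmin hax hσ

/-- … and conversely the summit gives `Ext(O(2))` vacuously (Clay (A) never fails). -/
theorem minimalDatumO2_of_navierStokesRegularity (h : NavierStokesRegularity) : MinimalDatumO2 := by
  intro ν hν hfail
  obtain ⟨v₀, hsm, hdiv, hdec, hno⟩ := hfail
  exact absurd (h ν hν v₀ hsm hdiv hdec) hno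

/-- **The `O(2)` bypass is summit-equivalent** — a relocation of the crux, not a weaker
intermediate (census §1, symmetry ledger). -/
theorem minimalDatumO2_iff : MinimalDatumO2 ↔ NavierStokesRegularity :=
  ⟨navierStokesRegularity_of_minimalDatumO2, minimalDatumO2_of_navierStokesRegularity⟩

/-! ## 3. Rows `D∞` and `C∞h`: the swirl-parity classes that remain open -/

/-- The rotation by `π` about the horizontal `x₀`-axis, `(x₀,x₁,x₂) ↦ (x₀,−x₁,−x₂)` (generates,
with the `R_θ`, the dihedral group `D∞ ⊂ SO(3)`; equivariance forces `u_θ` odd in `z`). -/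
def rotXpi (x : EuclideanSpace ℝ (Fin 3)) : EuclideanSpace ℝ (Fin 3) :=
  WithLp.toLp 2 ![x 0, -x 1, -x 2]

/-- The reflection in the horizontal plane `{x₂ = 0}`, `(x₀,x₁,x₂) ↦ (x₀,x₁,−x₂)` (generates, with
the `R_θ`, the group `C∞h`; equivariance forces `u_θ` even in `z`). -/
def reflZ (x : EuclideanSpace ℝ (Fin 3)) : EuclideanSpace ℝ (Fin 3) :=
  WithLp.toLp 2 ![x 0, x 1, -x 2]

/-- **Crux restricted to the class `D∞`** (axisymmetric, swirl odd in `z` — the symmetry class of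
Hou's potentially singular axisymmetric Navier–Stokes solution, arXiv:2107.06509 §2, `u₁` odd and
periodic in `z`).  Open; no regularity theorem for this class is in print. -/
def AxisymmetricKatoGlobalOddSwirl : Prop :=
  ∀ ν : ℝ, 0 < ν → ∀ (u₀ : EuclideanSpace ℝ (Fin 3) → EuclideanSpace ℝ (Fin 3))
    (g : Literature.Analysis.FunctionSpaces.HomSobolev (EuclideanSpace ℝ (Fin 3))
      (EuclideanSpace ℂ (Fin 3)) (1 / 2 : ℝ)),
    MemLp u₀ 3 volume → g.Represents (Literature.Analysis.FunctionSpaces.EuclideanSpace.complexify ∘ u₀) →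
    IsWeaklyDivFree u₀ → IsAxisymmetric u₀ → (∀ x, u₀ (rotXpi x) = rotXpi (u₀ x)) →
    HasGlobalKatoSolution ν u₀

/-- **Crux restricted to the class `C∞h`** (axisymmetric, swirl even in `z`).  Open. -/
def AxisymmetricKatoGlobalEvenSwirl : Prop :=
  ∀ ν : ℝ, 0 < ν → ∀ (u₀ : EuclideanSpace ℝ (Fin 3) → EuclideanSpace ℝ (Fin 3))
    (g : Literature.Analysis.FunctionSpaces.HomSobolev (EuclideanSpace ℝ (Fin 3))
      (EuclideanSpace ℂ (Fin 3)) (1 / 2 : ℝ)),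
    MemLp u₀ 3 volume → g.Represents (Literature.Analysis.FunctionSpaces.EuclideanSpace.complexify ∘ u₀) →
    IsWeaklyDivFree u₀ → IsAxisymmetric u₀ → (∀ x, u₀ (reflZ x) = reflZ (u₀ x)) →
    HasGlobalKatoSolution ν u₀

/-- Trivial weakening: the crux contains its `D∞` row. -/
theorem oddSwirl_of_axisymmetricKatoGlobal (h : AxisymmetricKatoGlobal) :
    AxisymmetricKatoGlobalOddSwirl :=
  fun ν hν u₀ g hL3 hrep hdiv hax _ => h ν hν u₀ g hL3 hrep hdiv (fun θ x => hax θ x)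

/-- Trivial weakening: the crux contains its `C∞h` row. -/
theorem evenSwirl_of_axisymmetricKatoGlobal (h : AxisymmetricKatoGlobal) :
    AxisymmetricKatoGlobalEvenSwirl :=
  fun ν hν u₀ g hL3 hrep hdiv hax _ => h ν hν u₀ g hL3 hrep hdiv (fun θ x => hax θ x)

end Summit.NavierStokesRegularity.NavierStokesRegularity.Cruxes.AxisymmetricKatoGlobal.StrategistS16g7
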